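import Summits.AnomalousDissipation.AnomalousDissipation.Theorems.SolenoidalFractalHomogenisationLagrangianStepVmodFrameSolDefs
import HarnessLib

/-!
# K1L_D (stmt-AnomalousDissipation-27980), (ℓ3-A) road A: the (ℓ3)-internal block texts v3 «J-CUT» — distorted blocks over FRAME-CORRECTED TEST
# CLASSES, the bundled local regularity predicate `IsFrameRegular`, and (M_θ) for twisted-adjacent classes
(Summits-side DEFINITIONS file of route `SolenoidalFractalHomogenisation`; review lane; prover ad-k1loc-p3 g11; tenure RULING D28-18 (1)(2):
F-p3g11-1 → (J-loc), F-p3g11-2 ACCEPTED, P-p3g11-1 ADOPTED; memo `HOME/ad-k1loc-p3/FSG-SPEC-p3g11-v2.md` §6, sketch `BlockBoundGJ-sketch-p3g11.lean` rc 0.)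

CONVENTION (D28-8′ line-1 rule): the distortion is DERIVATIVE-INDEX — `Torus.Visc4.conj M 𝔸 i c j e = Σ_{a,b} M c a * 𝔸 i a j b * M e b`, test operator
`Torus.viscAdjVar (fun y => conj (G t y) 𝔸)`; class variable `v = u ∘ X`; `Torus.distort G v = G·v` enters ONLY the constraint `∇·(G v) = 0`.
`J` denotes a pointwise INVERSE FRAME, `G t y * J t y = 1`.

WHY v3 (F-p3g11-2, D28-18 (2)).  The v2 block texts (`BlockBoundGF(S) … Px Pζ`) quantify RAW slow/fast tests `ζ`; every y-side block proof must replace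
`ζ` by an ADMISSIBLE test of the distorted weak class (`∇·(G t ψ) = 0` ⇔ `ψ = J(t)•φ`, `φ` flat weakly divergence free).  The exact replacement
`P^{G(t)}ζ` is free only at the ASSEMBLY level (Hilbert-space facts `…LossCurrencyForm`, p724446); inside a block every approximate replacement leaves an
`O(θ^k)·‖x‖·‖ζ‖` remainder, unaffordable in loss currency.  The J-CUT states the blocks for tests `J(t)•φ` with `φ` in a FLAT class: for slow `φ`
(a trigonometric polynomial) `J•φ` IS admissible and (D-GEN-J) (p724081) applies with zero replacement error.
* §1 `VmodDist.IsFrameRegular θ Tw nC G J` — the BUNDLED LOCAL regularity predicate of D28-18 (1) (NOT a field of `IsFrameModulation`, which stays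
  byte-identical): `G J = 1`; the four J-binders of p724081 (smooth slices · all iterated y-derivatives jointly continuous · time-Lipschitz on `[0,Tw]` ·
  an a.e.-in-t derivative with one null set for all y); the same joint continuity / a.e. derivative for `G`; graded sup bounds on the first two
  y-derivatives of `G` and `J` (`θ·nC^{|l|}`, `2θ·nC^{|l|}`).  Discharged for the one instance by `…FrameInstanceRegularity` (lead g7).  `isFrameRegular_one`.
* §2 `VmodDist.corrTest Jt φ : V2` — the NAMED COERCION of the corrected test `J(t)•φ` to `V2` (`MemLp.toLp` when `Torus.distort Jt φ ∈ L²`, else `0`;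
  junk-free spec lemmas `corrTest_eq_toLp`, `coeFn_corrTest`, `corrTest_one`).
* §3 the texts: **`BlockBoundGJ … Px Pφ`** := `BlockBoundGFS` VERBATIM except (i) `∀ J, IsFrameRegular θ Tw nC G J →` after the frame binder, (ii) the test
  line `∀ x φ : V2, Px n x → Pφ n φ → Torus.IsWeaklyDivFree (φ : VF) → |⟪U 0 t x − T 0 t x, corrTest (J t) φ⟫| ≤ alw·√q_T(x)·√q*_T(corrTest (J t) φ)`;
  **`NearMultGJ … κ`** := `NearMultGFS` with the same two changes, the adjoint clause on `(corrTest (J t) φs, corrTest (J t) φf)` bounding the LOSS-FORM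
  cross term `|⟪a,b⟫ − ⟪T†a, T†b⟫|` (for the data clause, flat classes at the reset, `⟪xs,xf⟫ = 0` and the loss form IS `−⟪T xs, T xf⟫`);
  `SlowVectorClauseModECW0FS` UNCHANGED; §4 (amendment 1, F-p3g11-3) `SlowVectorClauseModECW0FJ` = the same clause UNDER the `J`-binder — what the
  assembly port `…VmodFrameAssemblyJ` can deliver from J-cut blocks (head twin `vmod_EX_of_VRH0FJ`, lead g7) — and `modECW0FJ_of_modECW0FS`.
Definitions + trivial lemmas only; NOT a proof of any block, of (M_θ), of `stub_Vmod_EHTthg`, of K1L_D or of AD; rung F-D1.A0.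
-/

set_option linter.dupNamespace false

noncomputable section

namespace Summit.AnomalousDissipation.AnomalousDissipation.Theorems.SolenoidalFractalHomogenisation.LagrangianStep.VmodDist

open Literature.Analysis Literature.Analysis.FluidPDE Literature.Analysis.FunctionSpaces
open MeasureTheory Set Filter UnitAddTorus
open scoped ENNReal NNReal InnerProductSpace
open Summit.AnomalousDissipation.AnomalousDissipation.Theorems.SolenoidalFractalHomogenisation.LagrangianStep.CellClauseMod
open Summit.AnomalousDissipation.AnomalousDissipation.Theorems.SolenoidalFractalHomogenisation.LagrangianStep.LossCurrency
open Summit.AnomalousDissipation.AnomalousDissipation.Theorems.SolenoidalFractalHomogenisation.LagrangianStep.VmodFlat (IsSlow IsFast)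

/-! ## §1 The bundled local regularity predicate (D28-18 (1), (J-loc)) -/

/-- **`IsFrameRegular θ Tw nC G J`** — the joint `(t,y)`-regularity of a frame `G` and a pointwise inverse frame `J` that G-adapted admissible tests
of the distorted weak class need (FINDING F-p3g11-1), bundled as a LOCAL predicate on the (ℓ3)-internal texts (RULING D28-18 (1): the class of
record `IsFrameModulation` is NOT amended).  All fields are free for the one instance (clamped exact-flow frame, FR package). -/
structure IsFrameRegular (θ Tw nC : ℝ) (G J : ℝ → UnitAddTorus (Fin 3) → Matrix (Fin 3) (Fin 3) ℝ) : Prop where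
  /-- `J` is a pointwise inverse frame -/
  mul_eq_one : ∀ t y, G t y * J t y = 1
  /-- smooth slices of `J` (p724081 `hJs`) -/
  smooth : ∀ t a c, Torus.IsSmooth (fun y => J t y a c)
  /-- all iterated `y`-derivatives of the entries of `J` jointly continuous on `ℝ × 𝕋³` (p724081 `hJc`) -/
  jointCont : ∀ i j (l : List (Fin 3)), Continuous (Function.uncurry fun t y => Torus.iterPartialDeriv l (fun y => J t y i j) y)
  /-- entries of `J` Lipschitz in time on `[0,Tw]`, uniformly in `y` (p724081 `hJL`) -/
  lipschitz : ∃ K : ℝ, ∀ t ∈ Icc 0 Tw, ∀ s ∈ Icc 0 Tw, ∀ y a c, |J t y a c - J s y a c| ≤ K * |t - s|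
  /-- an a.e.-in-time derivative of `J`, one null set for all `y` (p724081 `hJ'`) -/
  aeDeriv : ∃ J' : ℝ → UnitAddTorus (Fin 3) → Matrix (Fin 3) (Fin 3) ℝ,
    ∀ᵐ t ∂(volume.restrict (Ioo 0 Tw)), ∀ y, HasDerivAt (fun s => J s y) (J' t y) t
  /-- the same joint continuity for the entries of `G` -/
  jointContG : ∀ i j (l : List (Fin 3)), Continuous (Function.uncurry fun t y => Torus.iterPartialDeriv l (fun y => G t y i j) y)
  /-- the same a.e.-in-time derivative for `G` (its bound `θ/Tw` is a lemma from `IsFrameModulation.rate`, not a field) -/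
  aeDerivG : ∃ G' : ℝ → UnitAddTorus (Fin 3) → Matrix (Fin 3) (Fin 3) ℝ,
    ∀ᵐ t ∂(volume.restrict (Ioo 0 Tw)), ∀ y, HasDerivAt (fun s => G s y) (G' t y) t
  /-- graded sup bounds on the first two `y`-derivatives of `G` and `J` on the window (length-1 `G`-clause duplicates `grad_le`; `l = []` excluded) -/
  derivBound : ∀ t ∈ Set.Icc 0 Tw, ∀ y i j (l : List (Fin 3)), 1 ≤ l.length → l.length ≤ 2 →
    |Torus.iterPartialDeriv l (fun y => G t y i j) y| ≤ θ * nC ^ l.length ∧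
    |Torus.iterPartialDeriv l (fun y => J t y i j) y| ≤ 2 * θ * nC ^ l.length

/-- Iterated derivatives of a constant vanish for nonempty words, and are the constant for the empty word. -/
theorem iterPartialDeriv_const_matrix (c : ℝ) (l : List (Fin 3)) (y : UnitAddTorus (Fin 3)) :
    Torus.iterPartialDeriv l (fun _ : UnitAddTorus (Fin 3) => c) y = if l = [] then c else 0 := by
  by_cases hl : l = []
  · subst hl; simp
  · rw [if_neg hl, Torus.iterPartialDeriv_const c l hl]; rfl

/-- **Degenerate instance** (certifier probe (P1)): the identity frame with itself as inverse is frame-regular at `θ = 0`. -/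
theorem isFrameRegular_one {Tw nC : ℝ} :
    IsFrameRegular 0 Tw nC (fun _ _ => (1 : Matrix (Fin 3) (Fin 3) ℝ)) (fun _ _ => (1 : Matrix (Fin 3) (Fin 3) ℝ)) where
  mul_eq_one := fun _ _ => Matrix.mul_one _
  smooth := fun _ a c => Torus.isSmooth_const _
  jointCont := fun i j l => by
    have e : (Function.uncurry fun (t : ℝ) (y : UnitAddTorus (Fin 3)) =>
        Torus.iterPartialDeriv l (fun _ : UnitAddTorus (Fin 3) => (1 : Matrix (Fin 3) (Fin 3) ℝ) i j) y)
        = fun _ => if l = [] then (1 : Matrix (Fin 3) (Fin 3) ℝ) i j else 0 := by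
      funext p; exact iterPartialDeriv_const_matrix _ l p.2
    rw [e]; exact continuous_const
  lipschitz := ⟨0, fun t _ s _ y a c => by simp⟩
  aeDeriv := ⟨fun _ _ => 0, Filter.Eventually.of_forall fun t y =>
    hasDerivAt_pi.2 fun i => hasDerivAt_pi.2 fun j => by simpa using hasDerivAt_const t ((1 : Matrix (Fin 3) (Fin 3) ℝ) i j)⟩
  jointContG := fun i j l => by
    have e : (Function.uncurry fun (t : ℝ) (y : UnitAddTorus (Fin 3)) =>
        Torus.iterPartialDeriv l (fun _ : UnitAddTorus (Fin 3) => (1 : Matrix (Fin 3) (Fin 3) ℝ) i j) y)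
        = fun _ => if l = [] then (1 : Matrix (Fin 3) (Fin 3) ℝ) i j else 0 := by
      funext p; exact iterPartialDeriv_const_matrix _ l p.2
    rw [e]; exact continuous_const
  aeDerivG := ⟨fun _ _ => 0, Filter.Eventually.of_forall fun t y =>
    hasDerivAt_pi.2 fun i => hasDerivAt_pi.2 fun j => by simpa using hasDerivAt_const t ((1 : Matrix (Fin 3) (Fin 3) ℝ) i j)⟩
  derivBound := fun t _ y i j l hl1 _ => by
    have hl : l ≠ [] := by intro h; rw [h] at hl1; simp at hl1
    rw [Torus.iterPartialDeriv_const _ l hl]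
    simp

/-! ## §2 The corrected test as an element of `V2` -/

open Classical in
/-- **The named coercion of the frame-corrected test to `V2`**: `corrTest Jt φ = J•φ` as an `L²` class when `Torus.distort Jt φ ∈ L²`
(always the case for a bounded continuous `Jt`), and the junk value `0` otherwise. -/
def corrTest (Jt : UnitAddTorus (Fin 3) → Matrix (Fin 3) (Fin 3) ℝ) (φ : V2) : V2 :=
  if h : MemLp (Torus.distort Jt ((φ : V2) : VF)) 2 volume then h.toLp _ else 0

/-- `corrTest Jt φ` is the `L²` class of `J•φ` whenever the latter is square integrable. -/
theorem corrTest_eq_toLp {Jt : UnitAddTorus (Fin 3) → Matrix (Fin 3) (Fin 3) ℝ} {φ : V2} (h : MemLp (Torus.distort Jt ((φ : V2) : VF)) 2 volume) :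
    corrTest Jt φ = h.toLp _ := by
  unfold corrTest; rw [dif_pos h]

/-- … hence a version of the function `J•φ`. -/
theorem coeFn_corrTest {Jt : UnitAddTorus (Fin 3) → Matrix (Fin 3) (Fin 3) ℝ} {φ : V2} (h : MemLp (Torus.distort Jt ((φ : V2) : VF)) 2 volume) :
    ((corrTest Jt φ : V2) : VF) =ᵐ[volume] Torus.distort Jt ((φ : V2) : VF) := by
  rw [corrTest_eq_toLp h]; exact h.coeFn_toLp

/-- Degenerate instance (certifier probe (P1)): with the identity frame the corrected test is the test, `corrTest 1 φ = φ`. -/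
theorem corrTest_one (φ : V2) : corrTest (fun _ => (1 : Matrix (Fin 3) (Fin 3) ℝ)) φ = φ := by
  have h1 : Torus.distort (fun _ => (1 : Matrix (Fin 3) (Fin 3) ℝ)) ((φ : V2) : VF) = ((φ : V2) : VF) := Torus.distort_one _
  have h : MemLp (Torus.distort (fun _ => (1 : Matrix (Fin 3) (Fin 3) ℝ)) ((φ : V2) : VF)) 2 volume := by rw [h1]; exact Lp.memLp φ
  rw [corrTest_eq_toLp h]
  have h2 : h.toLp _ = (Lp.memLp φ).toLp ((φ : V2) : VF) := (MemLp.toLp_eq_toLp_iff _ _).2 (by rw [h1])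
  rw [h2, Lp.toLp_coeFn]

/-! ## §3 The texts v3 «J-CUT» -/

/-- **`BlockBoundGJ` — the common DISTORTED block shape over FRAME-CORRECTED TEST CLASSES (v3, D28-18 (2)).**  `BlockBoundGFS` VERBATIM except:
(i) after the frame binder, `∀ J, IsFrameRegular θ Tw nC G J →`; (ii) the test is the corrected test `corrTest (J t) φ = J(t)•φ` of a field `φ`
in the FLAT class `Pφ n` which is weakly divergence free; the conclusion in the two losses of the coarse member at `x` and at `corrTest (J t) φ`.
Data side unchanged (flat class `Px n` at the reset, `G 0 = 1`). -/
def BlockBoundGJ {k : ℕ} (W : LatticeShear.LatticeWord k) (M : ℝ) (hM : 0 < M) (c : ℝ)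
    (Φ : ℝ → Torus.Visc4 (Fin 3) → Torus.Visc4 (Fin 3)) (lo hi Λ β σ Cb ν₀ K θ₁ ϱ₁ : ℝ) (Px Pφ : ℕ → V2 → Prop) : Prop :=
  ∀ ν, ∀ hν : ν ∈ Set.Ioo 0 ν₀, ∀ n : ℕ, (⌈K / ν⌉₊ : ℝ) ≤ n → ∀ 𝔸 : Torus.Visc4 (Fin 3),
    Torus.OddSmall 𝔸 (ν * β) → (∃ lam ∈ Set.Icc (1:ℝ) Λ, Torus.NearIso 𝔸 (ν * (lo / lam)) (ν * (hi * lam))) →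
    Torus.OddSmall (Φ ν ((1 / ν) • 𝔸)) β → (∃ lam ∈ Set.Icc (1:ℝ) Λ, Torus.NearIso (Φ ν ((1 / ν) • 𝔸)) (lo / lam) (hi * lam)) →
    ∀ θ ∈ Set.Icc 0 θ₁, ∀ nC : ℝ, 0 ≤ nC → nC ≤ ϱ₁ * n → ∀ Tw > (0:ℝ),
    ∀ G : ℝ → UnitAddTorus (Fin 3) → Matrix (Fin 3) (Fin 3) ℝ, IsFrameModulation θ Tw nC G →
    ∀ J : ℝ → UnitAddTorus (Fin 3) → Matrix (Fin 3) (Fin 3) ℝ, IsFrameRegular θ Tw nC G J →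
    ∀ U T : ℝ → ℝ → (V2 →L[ℝ] V2),
      IsDistortedPropagatorS Tw ((1 / (n:ℝ) ^ 2) • 𝔸) (cellField W M hM ν hν.1 n) G U →
      IsDistortedPropagatorS Tw ((1 / (n:ℝ) ^ 2) • (𝔸 + (c / ν) • Φ ν ((1 / ν) • 𝔸))) (fun _ _ => 0) G T →
    ∀ t : ℝ, 0 < t → t ≤ Tw → ∀ x φ : V2, Px n x → Pφ n φ → Torus.IsWeaklyDivFree ((φ : V2) : VF) →
      |⟪U 0 t x - T 0 t x, corrTest (J t) φ⟫_ℝ|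
        ≤ (Cb * (Cb * (ν ^ σ + ((⌈K / ν⌉₊ : ℝ) / n) ^ σ + θ ^ σ + (nC / n) ^ σ) + (min 1 ((M * W.period / ν) / t)) ^ σ))
          * Real.sqrt (lossFwd (T 0 t) x) * Real.sqrt (lossAdj (T 0 t) (corrTest (J t) φ))

/-- **`NearMultGJ` — (M_θ) for TWISTED-ADJACENT classes (v3, D28-18 (2)).**  `NearMultGFS` with the two changes of `BlockBoundGJ`; the data clause
(flat classes at the reset) is unchanged; the adjoint clause bounds the LOSS-FORM cross term `|⟪a,b⟫ − ⟪T†a, T†b⟫|` of the corrected tests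
`a = corrTest (J t) φs`, `b = corrTest (J t) φf` (`φs` slow, `φf` fast, weakly divergence free) — Cauchy–Schwarz gives `κ = 1` for free
(`LossCurrency.abs_inner_sub_inner_adjoint_le`), the content is `κ < 1`; it yields `q*(a) + q*(b) ≤ q*(a+b)/(1−κ)` in the assembly. -/
def NearMultGJ (c : ℝ) (Φ : ℝ → Torus.Visc4 (Fin 3) → Torus.Visc4 (Fin 3)) (lo hi Λ β ν₀ K θ₁ ϱ₁ κ : ℝ) : Prop :=
  ∀ ν : ℝ, ν ∈ Set.Ioo 0 ν₀ → ∀ n : ℕ, (⌈K / ν⌉₊ : ℝ) ≤ n → ∀ 𝔸 : Torus.Visc4 (Fin 3),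
    Torus.OddSmall 𝔸 (ν * β) → (∃ lam ∈ Set.Icc (1:ℝ) Λ, Torus.NearIso 𝔸 (ν * (lo / lam)) (ν * (hi * lam))) →
    Torus.OddSmall (Φ ν ((1 / ν) • 𝔸)) β → (∃ lam ∈ Set.Icc (1:ℝ) Λ, Torus.NearIso (Φ ν ((1 / ν) • 𝔸)) (lo / lam) (hi * lam)) →
    ∀ θ ∈ Set.Icc 0 θ₁, ∀ nC : ℝ, 0 ≤ nC → nC ≤ ϱ₁ * n → ∀ Tw > (0:ℝ),
    ∀ G : ℝ → UnitAddTorus (Fin 3) → Matrix (Fin 3) (Fin 3) ℝ, IsFrameModulation θ Tw nC G →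
    ∀ J : ℝ → UnitAddTorus (Fin 3) → Matrix (Fin 3) (Fin 3) ℝ, IsFrameRegular θ Tw nC G J →
    ∀ T : ℝ → ℝ → (V2 →L[ℝ] V2),
      IsDistortedPropagatorS Tw ((1 / (n:ℝ) ^ 2) • (𝔸 + (c / ν) • Φ ν ((1 / ν) • 𝔸))) (fun _ _ => 0) G T →
    ∀ t : ℝ, 0 < t → t ≤ Tw →
      (∀ xs xf : V2, IsSlow n xs → IsFast n xf →
        |⟪T 0 t xs, T 0 t xf⟫_ℝ| ≤ κ * Real.sqrt (lossFwd (T 0 t) xs) * Real.sqrt (lossFwd (T 0 t) xf)) ∧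
      (∀ φs φf : V2, IsSlow n φs → IsFast n φf →
        Torus.IsWeaklyDivFree ((φs : V2) : VF) → Torus.IsWeaklyDivFree ((φf : V2) : VF) →
        |⟪corrTest (J t) φs, corrTest (J t) φf⟫_ℝ
            - ⟪ContinuousLinearMap.adjoint (T 0 t) (corrTest (J t) φs), ContinuousLinearMap.adjoint (T 0 t) (corrTest (J t) φf)⟫_ℝ|
          ≤ κ * Real.sqrt (lossAdj (T 0 t) (corrTest (J t) φs)) * Real.sqrt (lossAdj (T 0 t) (corrTest (J t) φf)))

/-! ## §4 Amendment 1 (FINDING F-p3g11-3): the clause handed to the head carries the `J`-binder -/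

/-- **(V_modECW0FJ)** — `SlowVectorClauseModECW0FS` VERBATIM except the extra binders `∀ J, IsFrameRegular θ Tw nC G J →` after the frame binder
(FINDING F-p3g11-3: the J-cut blocks and `NearMultGJ` need `IsFrameRegular`, which is NOT derivable from `IsFrameModulation` (F-p3g11-1 / D28-18 (1)
(J-loc)); hence the assembly `…VmodFrameAssemblyJ` can only deliver the clause UNDER the `J`-binder, and the head twin `vmod_EX_of_VRH0FJ` (lead g7)
discharges it at the instance with `…FrameInstanceRegularity`).  The registered texts are untouched. [cite: ArmstrongVicol2025, §4.1 (PDF p. 34)] -/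
def SlowVectorClauseModECW0FJ {k : ℕ} (W : LatticeShear.LatticeWord k) (M : ℝ) (hM : 0 < M) (c : ℝ)
    (Φ : ℝ → Torus.Visc4 (Fin 3) → Torus.Visc4 (Fin 3)) (lo hi Λ β σ C ν₀ K θ₁ ϱ₁ : ℝ) : Prop :=
  ∀ ν, ∀ hν : ν ∈ Set.Ioo 0 ν₀, ∀ n : ℕ, (⌈K / ν⌉₊ : ℝ) ≤ n → ∀ 𝔸 : Torus.Visc4 (Fin 3),
    Torus.OddSmall 𝔸 (ν * β) → (∃ lam ∈ Set.Icc (1:ℝ) Λ, Torus.NearIso 𝔸 (ν * (lo / lam)) (ν * (hi * lam))) →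
    Torus.OddSmall (Φ ν ((1 / ν) • 𝔸)) β → (∃ lam ∈ Set.Icc (1:ℝ) Λ, Torus.NearIso (Φ ν ((1 / ν) • 𝔸)) (lo / lam) (hi * lam)) →
    ∀ θ ∈ Set.Icc 0 θ₁, ∀ nC : ℝ, 0 ≤ nC → nC ≤ ϱ₁ * n → ∀ Tw > (0:ℝ),
    ∀ G : ℝ → UnitAddTorus (Fin 3) → Matrix (Fin 3) (Fin 3) ℝ, IsFrameModulation θ Tw nC G →
    ∀ J : ℝ → UnitAddTorus (Fin 3) → Matrix (Fin 3) (Fin 3) ℝ, IsFrameRegular θ Tw nC G J →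
    ∀ U T : ℝ → ℝ → (V2 →L[ℝ] V2),
      IsDistortedPropagatorS Tw ((1 / (n:ℝ) ^ 2) • 𝔸) (cellField W M hM ν hν.1 n) G U →
      IsDistortedPropagatorS Tw ((1 / (n:ℝ) ^ 2) • (𝔸 + (c / ν) • Φ ν ((1 / ν) • 𝔸))) (fun _ _ => 0) G T →
    ∀ t : ℝ, 0 < t → t ≤ Tw → ∀ x ζ : V2,
      |⟪U 0 t x - T 0 t x, ζ⟫_ℝ|
        ≤ (C * (C * (ν ^ σ + ((⌈K / ν⌉₊ : ℝ) / n) ^ σ + θ ^ σ + (nC / n) ^ σ) + (min 1 ((M * W.period / ν) / t)) ^ σ))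
          * Real.sqrt (lossFwd (T 0 t) x) * Real.sqrt (lossAdj (T 0 t) ζ)

/-- Weakening: the J-free clause `ModECW0FS` implies the J-binder clause (ignore `J`). -/
theorem modECW0FJ_of_modECW0FS {k : ℕ} {W : LatticeShear.LatticeWord k} {M : ℝ} {hM : 0 < M} {c : ℝ}
    {Φ : ℝ → Torus.Visc4 (Fin 3) → Torus.Visc4 (Fin 3)} {lo hi Λ β σ C ν₀ K θ₁ ϱ₁ : ℝ}
    (h : SlowVectorClauseModECW0FS W M hM c Φ lo hi Λ β σ C ν₀ K θ₁ ϱ₁) : SlowVectorClauseModECW0FJ W M hM c Φ lo hi Λ β σ C ν₀ K θ₁ ϱ₁ :=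
  fun ν hν n hn 𝔸 hodd hwin hΦo hΦw θ hθ nC hnC0 hnC Tw hTw G hG _ _ U T hU hT =>
    h ν hν n hn 𝔸 hodd hwin hΦo hΦw θ hθ nC hnC0 hnC Tw hTw G hG U T hU hT

end Summit.AnomalousDissipation.AnomalousDissipation.Theorems.SolenoidalFractalHomogenisation.LagrangianStep.VmodDist

end
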